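import Literature.NumberTheory.Automorphic.ShintaniWhittakerFormula
import Literature.NumberTheory.Automorphic.IwasawaDecompositionGL
import Literature.NumberTheory.Automorphic.SatakeParametersGLProofs
import HarnessLib

/-!
# The spherical Whittaker function does not vanish at the identity

Topic `NumberTheory/Automorphic`; theorems only (no definition, no named fact). Over the tree's
notions (`whittakerFunctionals`, `whittakerModel` of `WhittakerModels`; `glInt n F = K₀ = GL_n(𝒪)`,
`heckeT`, `IsSatakeParameter` of `SatakeParametersGL`; `AddChar.HasConductorExp` of
`TateLocalFactors`) we prove the non-vanishing half of the Casselman–Shalika / Shintani evaluation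
of the class-one Whittaker function:

* `whittakerModel_apply_one_ne_zero_of_spherical` (**`W°(1) ≠ 0`**): let `ρ` be an IRREDUCIBLE
  representation of `GL_n(F)` (`F` a non-archimedean local field), `ψ` of conductor `𝒪`
  (`ψ.HasConductorExp 0`), `Λ ≠ 0` a `ψ`-Whittaker functional, and `v ≠ 0` a `K₀`-fixed vector which
  is an eigenvector of the Hecke operators `T_r`, `1 ≤ r ≤ n`, with eigenvalues `q^{r(n-r)/2} e_r(x)`
  (e.g. the vector of `IsSatakeParameter ρ ϖ α`, `x` enumerating `α`). Then `Λ(v) = W_v(1) ≠ 0`.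
* `exists_spherical_whittaker_ne_zero_of_isSatakeParameter`: the same packaged for
  `IsSatakeParameter`.

So the spherical Whittaker function `W° = W_v` can be normalised by `W°(1) = 1`, as the sources do
before computing the unramified Rankin–Selberg integral `Ψ(s; W°, W'°) = det(1 - q^{-s} A ⊗ A')⁻¹`
(Jacquet–Shalika 1981, §2; Cogdell, Thm. 3.3: "there will be unique normalized `K`-fixed Whittaker
functions … normalized by `W°(e) = W'°(e) = 1`"); with `Λ(v) = 0` that integral — a multiple of
`Λ(v) Λ'(v')` by Shintani's formula — would vanish identically and could not exhibit the
`L`-factor (clause (b) of `HasRSLFactor` of `RankinSelbergLocal`).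

## Proof

Suppose `Λ(v) = 0`. By Shintani's formula (`whittakerModel_piPowGL_eq` of
`ShintaniWhittakerFormula`: `W_v(ϖ^μ) = q^{-b(μ)/2} s_μ(x) Λ(v)` for antitone `μ ∈ ℕⁿ`, and
`apply_piPowGL_eq_zero_of_not_antitone`: `W_v(ϖ^ν) = 0` for non-antitone `ν`) `W_v` vanishes on
`ϖ^{ℕⁿ}`. The top Hecke operator is `T_n = ρ(ϖ · 1)` on `V^{K₀}` (`heckeT_self_apply` of
`SatakeParametersGLProofs`), so `ρ(ϖ · 1) v = e v` with `e = e_n(x) ≠ 0` (`ρ(ϖ · 1)` is invertible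
and `v ≠ 0`), hence `ρ((ϖ · 1)^{-N}) v = e^{-N} v` and, writing `μ ∈ ℤⁿ` as `μ = μ⁺ - N · 1` with
`μ⁺ ∈ ℕⁿ`, `W_v(ϖ^μ) = e^{-N} W_v(ϖ^{μ⁺}) = 0`: `W_v` vanishes on the whole torus `ϖ^{ℤⁿ}`. By the
Iwasawa decomposition `g = u ϖ^μ k` (`exists_unipotent_mul_zpowDiagGL_mul_glInt` of
`IwasawaDecompositionGL`) and `W_v(u ϖ^μ k) = ψ_U(u) W_v(ϖ^μ)` (`Λ` is `ψ_U`-equivariant, `v` is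
`K₀`-fixed), `W_v ≡ 0`. But for irreducible `ρ` and `Λ ≠ 0` the model map `v ↦ W_v` is injective
(`whittakerModel_injective_of_ne_zero` of `WhittakerModelsProofs`: its kernel is a proper `G`-stable
subspace), so `v = 0` — a contradiction. This is the standard deduction of `W°(1) ≠ 0` from the
explicit formula (Casselman–Shalika 1980, Thm. 5.4 and §5; Shintani 1976; Cogdell 2004, §7); no
measure theory or analysis enters.

## References

* W. Casselman, J. Shalika, *The unramified principal series of `p`-adic groups II: the Whittaker
  function*, Compositio Math. 41 (1980), 207–231, Thm. 5.4 [CasselmanShalika1980].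
* T. Shintani, *On an explicit formula for class-1 "Whittaker functions" on `GL_n` over `P`-adic
  fields*, Proc. Japan Acad. 52 (1976), 180–182 [Shintani1976].
* J. W. Cogdell, *Analytic theory of `L`-functions for `GL_n`*, in Bernstein–Gelbart (eds.),
  *An Introduction to the Langlands Program*, §3.1, Thm. 3.3 (read, held copy pp. 194–195)
  [CogdellAnalyticTheory2004].
-/

set_option autoImplicit false

noncomputable section

open ValuativeRel Matrix Finset Literature.RingTheory.SymmetricFunctions.SymmPoly
open scoped NNReal
open Literature.NumberTheory.GaloisRepresentations.IsNonarchimedeanLocalField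

namespace Literature.NumberTheory.Automorphic

section Torus

variable {F : Type*} [Field F] {n : ℕ}

/-- `ϖ^{(1,…,1)} = ϖ · 1 = heckeDiag n ϖ n` (the central element whose double coset gives `T_n`).
[folklore] -/
theorem zpowDiagGL_const_one {ϖ : F} (hϖ : ϖ ≠ 0) :
    zpowDiagGL (n := n) hϖ (fun _ => (1 : ℤ)) = heckeDiag n (Units.mk0 ϖ hϖ) n := by
  refine Units.ext ?_
  rw [coe_zpowDiagGL, coe_heckeDiag]
  congr 1
  funext j
  rw [zpow_one, if_pos j.isLt, Units.val_mk0]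

/-- `ϖ^{(-N,…,-N)} = ((ϖ · 1)⁻¹)^N`. [folklore] -/
theorem zpowDiagGL_const_neg_natCast {ϖ : F} (hϖ : ϖ ≠ 0) (N : ℕ) :
    zpowDiagGL (n := n) hϖ (fun _ => -(N : ℤ)) = (heckeDiag n (Units.mk0 ϖ hϖ) n)⁻¹ ^ N := by
  induction N with
  | zero =>
    have h0 : (fun _ : Fin n => -((0 : ℕ) : ℤ)) = 0 := by
      funext i
      simp
    rw [h0, zpowDiagGL_zero, pow_zero]
  | succ N ih =>
    have hsplit : (fun _ : Fin n => -((N + 1 : ℕ) : ℤ)) =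
        (fun _ : Fin n => -(N : ℤ)) + -(fun _ : Fin n => (1 : ℤ)) := by
      funext i
      simp only [Pi.add_apply, Pi.neg_apply, Nat.cast_add, Nat.cast_one]
      ring
    rw [hsplit, zpowDiagGL_add, zpowDiagGL_neg, ih, zpowDiagGL_const_one, pow_succ]

/-- Splitting an integral exponent vector into a natural one and a central shift:
`μ = μ⁺ - N · 1` with `N = ∑ |μ_i|`, `μ⁺_i = μ_i + N ≥ 0`. [folklore] -/
theorem exists_natCast_add_const_neg (m : Fin n → ℤ) :
    ∃ (mp : Fin n → ℕ) (N : ℕ), m = (fun i => ((mp i : ℕ) : ℤ)) + fun _ => -(N : ℤ) := by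
  classical
  set N : ℕ := ∑ i, (m i).natAbs with hN
  have hle : ∀ i, (m i).natAbs ≤ N := fun i =>
    Finset.single_le_sum (f := fun j => (m j).natAbs) (fun j _ => Nat.zero_le _) (Finset.mem_univ i)
  have hnn : ∀ i, 0 ≤ m i + N := fun i => by
    have h1 : -((m i).natAbs : ℤ) ≤ m i := by
      rw [Int.natCast_natAbs]
      exact neg_abs_le (m i)
    have h2 : ((m i).natAbs : ℤ) ≤ (N : ℤ) := by exact_mod_cast hle i
    linarith
  refine ⟨fun i => (m i + N).toNat, N, ?_⟩
  funext i
  simp only [Pi.add_apply]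
  rw [Int.toNat_of_nonneg (hnn i)]
  ring

end Torus

section Nonvanishing

variable {F : Type*} [Field F] [ValuativeRel F] [TopologicalSpace F] [IsNonarchimedeanLocalField F]
  {n : ℕ} {V : Type*} [AddCommGroup V] [Module ℂ V] (ρ : Representation ℂ (GL (Fin n) F) V)

omit [TopologicalSpace F] [IsNonarchimedeanLocalField F] in
/-- **The central element `ϖ · 1` acts on a `K₀`-fixed `T_n`-eigenvector by its (non-zero)
eigenvalue, and so do its negative powers**: if `T_n v = e v` then `e ≠ 0` and
`ρ(((ϖ · 1)⁻¹)^N) v = e^{-N} v`. (`T_n = ρ(ϖ · 1)` on `V^{K₀}`, `heckeT_self_apply`.) [folklore] -/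
theorem apply_heckeDiag_self_inv_pow_of_eigen (ϖ : Fˣ) {v : V} (hv : v ∈ ρ.fixedPoints (glInt n F))
    (hv0 : v ≠ 0) {e : ℂ} (he : heckeT ρ ϖ n v = e • v) (N : ℕ) :
    e ≠ 0 ∧ ρ ((heckeDiag n ϖ n)⁻¹ ^ N) v = (e⁻¹ ^ N) • v := by
  rw [heckeT_self_apply ρ ϖ hv] at he
  have he0 : e ≠ 0 := by
    rintro rfl
    rw [zero_smul] at he
    apply hv0
    have := congrArg (ρ (heckeDiag n ϖ n)⁻¹) he
    rwa [map_zero, ← Module.End.mul_apply, ← map_mul, inv_mul_cancel, map_one,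
      Module.End.one_apply] at this
  refine ⟨he0, ?_⟩
  have hinv : ρ (heckeDiag n ϖ n)⁻¹ v = e⁻¹ • v := by
    have := congrArg (ρ (heckeDiag n ϖ n)⁻¹) he
    rw [← Module.End.mul_apply, ← map_mul, inv_mul_cancel, map_one, Module.End.one_apply,
      map_smul] at this
    calc ρ (heckeDiag n ϖ n)⁻¹ v = e⁻¹ • e • ρ (heckeDiag n ϖ n)⁻¹ v := by
          rw [smul_smul, inv_mul_cancel₀ he0, one_smul]
      _ = e⁻¹ • v := by rw [← this]
  induction N with
  | zero => rw [pow_zero, pow_zero, map_one, Module.End.one_apply, one_smul]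
  | succ N ih =>
    rw [pow_succ, map_mul, Module.End.mul_apply, hinv, map_smul, ih, smul_smul, ← pow_succ']

/-- **The class-one Whittaker function does not vanish at `1`** (Casselman–Shalika 1980, Thm. 5.4;
Shintani 1976; the normalisation `W°(e) = 1` of Jacquet–Shalika 1981 §2 / Cogdell Thm. 3.3).
Let `ρ` be an irreducible representation of `GL_n(F)`, `ψ` an additive character of conductor `𝒪`,
`Λ ≠ 0` a `ψ`-Whittaker functional, and `v ≠ 0` a `GL_n(𝒪)`-fixed vector with
`T_r v = q^{r(n-r)/2} e_r(x) v` for `1 ≤ r ≤ n` (`ϖ` a uniformiser). Then `Λ(v) ≠ 0`.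
Proof: otherwise Shintani's formula and the central action make `W_v` vanish on the torus
`ϖ^{ℤⁿ}`, hence everywhere by the Iwasawa decomposition `G = U ϖ^{ℤⁿ} K₀`, contradicting the
injectivity of `v ↦ W_v` for irreducible `ρ`. [cite: CasselmanShalika1980, Thm. 5.4] -/
theorem whittakerModel_apply_one_ne_zero_of_spherical [ρ.IsIrreducible] {ϖ : F}
    (hϖ : IsUniformizingElement ϖ) {ψ : AddChar F Circle} (hψ : ψ.HasConductorExp 0)
    {Λ : Module.Dual ℂ V} (hΛ : Λ ∈ whittakerFunctionals ρ ψ) (hΛ0 : Λ ≠ 0) {v : V}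
    (hv : v ∈ ρ.fixedPoints (glInt n F)) (hv0 : v ≠ 0) {x : Fin n → ℂ}
    (hT : ∀ r, 1 ≤ r → r ≤ n → heckeT ρ (Units.mk0 ϖ hϖ.ne_zero) r v =
      ((((Real.sqrt (residueFieldCard F)) ^ (r * (n - r)) : ℝ) : ℂ) * esymm x r) • v) :
    Λ v ≠ 0 := by
  intro hΛv
  apply hv0
  apply whittakerModel_injective_of_ne_zero ρ hΛ0
  rw [map_zero]
  -- the Whittaker function of `v` and its equivariance properties
  set W : GL (Fin n) F → ℂ := whittakerModel ρ Λ v with hW_def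
  have hW : ∀ (u : ↥(upperUnitriangular (Fin n) F)) (g : GL (Fin n) F),
      W ((u : GL (Fin n) F) * g) = whittakerCharFun ψ u * W g := fun u g => by
    rw [hW_def, whittakerModel_apply, whittakerModel_apply, map_mul, Module.End.mul_apply, hΛ]
  have hK : ∀ k ∈ glInt n F, ∀ g, W (g * k) = W g := fun k hk g => by
    rw [hW_def, whittakerModel_apply, whittakerModel_apply, map_mul, Module.End.mul_apply,
      (ρ.mem_fixedPoints _ v).1 hv k hk]
  -- `W` vanishes on `ϖ^{ℕⁿ}`
  have hnat : ∀ mu : Fin n → ℕ, W (piPowGL hϖ.ne_zero mu) = 0 := by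
    intro mu
    by_cases hmu : Antitone mu
    · rw [hW_def, whittakerModel_piPowGL_eq ρ hϖ hψ hΛ hv hT hmu, hΛv, mul_zero]
    · exact apply_piPowGL_eq_zero_of_not_antitone hϖ (hψ.exists_apply_inv_mul_ne_one hϖ) hW hK hmu
  -- `W` vanishes on `ϖ^{ℤⁿ}`
  have hint : ∀ m : Fin n → ℤ, W (zpowDiagGL hϖ.ne_zero m) = 0 := by
    intro m
    obtain ⟨mp, N, rfl⟩ := exists_natCast_add_const_neg m
    rcases Nat.eq_zero_or_pos n with hn | hn
    · -- `GL_0(F)` is trivial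
      subst hn
      have h1 : zpowDiagGL hϖ.ne_zero ((fun i => ((mp i : ℕ) : ℤ)) + fun _ => -(N : ℤ)) =
          piPowGL hϖ.ne_zero mp := Units.ext (Subsingleton.elim _ _)
      rw [h1]
      exact hnat mp
    · obtain ⟨-, hpow⟩ := apply_heckeDiag_self_inv_pow_of_eigen ρ (Units.mk0 ϖ hϖ.ne_zero) hv hv0
        (hT n hn le_rfl) N
      rw [zpowDiagGL_add, zpowDiagGL_natCast, zpowDiagGL_const_neg_natCast, hW_def,
        whittakerModel_apply, map_mul, Module.End.mul_apply, hpow, map_smul, map_smul, smul_eq_mul,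
        ← whittakerModel_apply, ← hW_def, hnat mp, mul_zero]
  -- `W ≡ 0` by the Iwasawa decomposition
  funext g
  obtain ⟨u, hu, m, k, hk, rfl⟩ := exists_unipotent_mul_zpowDiagGL_mul_glInt hϖ g
  change W _ = 0
  rw [hK k hk, show u = ((⟨u, hu⟩ : ↥(upperUnitriangular (Fin n) F)) : GL (Fin n) F) from rfl,
    hW, hint, mul_zero]

/-- **Corollary for Satake parameters.** If `α` is a Satake parameter of the irreducible `ρ`
(`IsSatakeParameter ρ ϖ α`: some non-zero `v ∈ V^{K₀}` has `T_i v = q^{i(n-i)/2} e_i(α) v`), `ϖ` is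
uniformising and `ψ` has conductor `𝒪`, then every non-zero `ψ`-Whittaker functional `Λ` is
non-zero on such a vector: there is `v ∈ V^{K₀}`, `v ≠ 0`, with the Hecke eigenvalues of `α` and
`Λ(v) ≠ 0` (so `W_v/Λ(v)` is the normalised spherical Whittaker function, `W°(1) = 1`).
[cite: CasselmanShalika1980, Thm. 5.4] -/
theorem exists_spherical_whittaker_ne_zero_of_isSatakeParameter [ρ.IsIrreducible] {ϖ : Fˣ}
    (hϖ : IsUniformizingElement (ϖ : F)) {ψ : AddChar F Circle} (hψ : ψ.HasConductorExp 0)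
    {α : Multiset ℂ} (hα : IsSatakeParameter ρ ϖ α) {Λ : Module.Dual ℂ V}
    (hΛ : Λ ∈ whittakerFunctionals ρ ψ) (hΛ0 : Λ ≠ 0) :
    ∃ v ∈ ρ.fixedPoints (glInt n F), v ≠ 0 ∧ Λ v ≠ 0 ∧
      ∀ i ≤ n, heckeT ρ ϖ i v =
        (((Real.sqrt (residueFieldCard F) ^ (i * (n - i)) : ℝ) : ℂ) * α.esymm i) • v := by
  obtain ⟨hcard, v, hv, hv0, hTv⟩ := hα
  obtain ⟨x, hx⟩ := exists_univ_val_map_eq (R := ℂ) hcard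
  refine ⟨v, hv, hv0, ?_, hTv⟩
  have hmk : Units.mk0 (ϖ : F) hϖ.ne_zero = ϖ := Units.mk0_val _ _
  refine whittakerModel_apply_one_ne_zero_of_spherical ρ hϖ hψ hΛ hΛ0 hv hv0 (x := x)
    (fun r _ hrn => ?_)
  rw [hmk, hTv r hrn, ← hx, ← esymm_eq_multiset_esymm]

end Nonvanishing

end Literature.NumberTheory.Automorphic
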